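import Mathlib
import Summits.ResolutionOfSingularities.ResolutionOfSingularities.Theorems.RadicialJungCleanModelsStubCleanCharts3
import HarnessLib

/-!
# Route `RadicialJung`, crux `CleanModels` (stmt-15917): stub 4a (clean charts) from clean local uniformization at
# ZERO-DIMENSIONAL valuations only

Line `Sketch` (rev 17 → 18) of crux stmt-ResolutionOfSingularities-15917; lead `res-B-lead-1` g2.  OURS; nothing here proves resolution in
characteristic `p`.

The landed stub 4a `stub_cleanCharts3` (✓ p669538) consumes `CleanLU3` (`hLU`) for ALL valuation rings with a 3-dimensional regular
centre, but its proof applies `hLU` only at the ZERO-DIMENSIONAL refinement `O₀` of `exists_zeroDim_refinement` — a valuation ring all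
of whose centres on subrings `T ⊇ A` are maximal ideals.  This file records that sharper dependence: the same proof, verbatim, with
`hLU` asked only for such `O` (extra hypothesis `∀ T ≤ O, A ⊆ T → (𝔪_O ∩ T) maximal`).  It lets the skeleton restrict the research
residue `stub_cleanLU3Defect` to zero-dimensional valuations (residue field algebraic over `k`).
-/

noncomputable section

set_option linter.dupNamespace false -- mandated namespace of this single-conjunct summit

open IsLocalRing
open Literature.AlgebraicGeometry.Resolution

namespace Summit.ResolutionOfSingularities.ResolutionOfSingularities.Theorems.RadicialJung.CleanModels

variable {K : Type} [Field K] {p : ℕ}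

/-- **Stub 4a for zero-dimensional valuations (Sketch rev 18): CLEAN CHARTS inside every valuation ring centred on a regular affine
threefold chart**, from clean local uniformization at 3-dimensional centres of ZERO-DIMENSIONAL valuation rings only (`hLU` =
`CleanLU3` restricted to valuation rings all of whose centres above `A` are closed points — exactly where the landed proof of
`stub_cleanCharts3` (✓ p669538) applies it, after `exists_zeroDim_refinement`).  See the module docstring
for the proof (zero-dimensional refinement, `CleanLU3` at the refinement, spreading from the closed centre, regular locus,
inverting one element). [cite: Piltant2013, §2 Axiom 5 and Axiom 1] -/
theorem cleanCharts3_of_cleanLU3ZeroDim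
    (hLU : ∀ (p : ℕ), p.Prime →
    ∀ (k : Type) [Field k] [CharP k p] (K : Type) [Field K] [Algebra k K]
    (O : ValuationSubring K) (A : Subalgebra k K), A.toSubring ≤ O.toSubring → A.FG → IsFractionRing A K →
    ringKrullDim A ≤ 3 → IsRegularLocalRing (locAtCentre A.toSubring O) →
    ringKrullDim (locAtCentre A.toSubring O) = 3 →
    (∀ (T : Subring K) (hT : T ≤ O.toSubring), A.toSubring ≤ T → (subringCentre T O hT).IsMaximal) →
    ∀ g₀ : K, (∀ c : K, c ^ p ≠ g₀) →
    ∃ (A' : Subalgebra k K), A'.toSubring ≤ O.toSubring ∧ A ≤ A' ∧ A'.FG ∧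
    ∃ (_ : IsRegularLocalRing (locAtCentre A'.toSubring O)) (c : Fin p → K), (∃ j : Fin p, (j : ℕ) ≠ 0 ∧ c j ≠ 0) ∧
    ((∃ (d m : ℕ) (hmd : m ≤ d) (t : Fin d → ↥(locAtCentre A'.toSubring O)) (a : Fin m → ℕ) (u : ↥(locAtCentre A'.toSubring O)), IsUnit u ∧
    Ideal.span (Set.range t) = IsLocalRing.maximalIdeal ↥(locAtCentre A'.toSubring O) ∧
    ringKrullDim ↥(locAtCentre A'.toSubring O) = (d : WithBot ℕ∞) ∧ 0 < m ∧ (∀ i, ¬ p ∣ a i) ∧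
    (∑ j : Fin p, c j ^ p * g₀ ^ (j : ℕ)) = (u : K) * ∏ i : Fin m, ((t (Fin.castLE hmd i) : ↥(locAtCentre A'.toSubring O)) : K) ^ (a i)) ∨
    (∃ u : ↥(locAtCentre A'.toSubring O), IsUnit u ∧ (∑ j : Fin p, c j ^ p * g₀ ^ (j : ℕ)) = (u : K) ∧
    ∀ c' : ↥(locAtCentre A'.toSubring O), u - c' ^ p ∉ IsLocalRing.maximalIdeal ↥(locAtCentre A'.toSubring O)) ∨
    (∃ s c' : ↥(locAtCentre A'.toSubring O), (∑ j : Fin p, c j ^ p * g₀ ^ (j : ℕ)) = (s : K) ∧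
    s - c' ^ p ∈ IsLocalRing.maximalIdeal ↥(locAtCentre A'.toSubring O) ∧
    s - c' ^ p ∉ IsLocalRing.maximalIdeal ↥(locAtCentre A'.toSubring O) ^ 2))) :
    ∀ (p : ℕ), p.Prime → ∀ (k : Type) [Field k] [CharP k p] (K : Type) [Field K] [Algebra k K]
      (O : ValuationSubring K) (A : Subalgebra k K), A.toSubring ≤ O.toSubring → A.FG → IsFractionRing A K →
      ringKrullDim A ≤ 3 →
      (∀ (𝔪 : Ideal A.toSubring) [𝔪.IsMaximal],
        IsRegularLocalRing (Localization.AtPrime 𝔪) ∧ ringKrullDim (Localization.AtPrime 𝔪) = 3) →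
      ∀ g₀ : K, (∀ c : K, c ^ p ≠ g₀) →
      ∃ T : Subalgebra k K, T.FG ∧ A ≤ T ∧ T.toSubring ≤ O.toSubring ∧
        ∀ O' : ValuationSubring K, T.toSubring ≤ O'.toSubring →
          CleanRegAt p (locAtCentre T.toSubring O').subtype g₀ := by
  intro p hp k _ _ K _ _ O A hAO hAfg hfrac hdimA hmax g₀ hg₀
  classical
  haveI : Fact p.Prime := ⟨hp⟩
  haveI : CharP K p := charP_of_injective_algebraMap (algebraMap k K).injective p
  -- (1) a zero-dimensional refinement `A ⊆ O₀ ≤ O`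
  obtain ⟨O₀, hO₀O, hAO₀, hzd⟩ := exists_zeroDim_refinement O A.toSubring hAO
  -- (2) its centre on `A` is maximal: `A_𝔭` regular of dimension `3`
  haveI h𝔪 : (subringCentre A.toSubring O₀ hAO₀).IsMaximal := hzd A.toSubring hAO₀ le_rfl
  obtain ⟨hreg𝔪, hdim𝔪⟩ := hmax (subringCentre A.toSubring O₀ hAO₀)
  have hregO₀ : IsRegularLocalRing (locAtCentre A.toSubring O₀) :=
    (isRegularLocalRing_locAtCentre_iff hAO₀).mpr hreg𝔪
  have hdimO₀ : ringKrullDim (locAtCentre A.toSubring O₀) = 3 := by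
    rw [← ringKrullDim_eq_of_ringEquiv (locAtCentreEquiv hAO₀).toRingEquiv]; exact hdim𝔪
  -- (3) clean local uniformization at `O₀`
  obtain ⟨A', hA'O₀, hAA', hA'fg, hregR, c, hc, hloose⟩ :=
    hLU p hp k K O₀ A hAO₀ hAfg hfrac hdimA hregO₀ hdimO₀ hzd g₀ hg₀
  have hAA's : A.toSubring ≤ A'.toSubring := fun x hx => hAA' hx
  have h𝔭' : (subringCentre A'.toSubring O₀ hA'O₀).IsMaximal := hzd A'.toSubring hA'O₀ hAA's
  have hX : LooseCleanForm p (locAtCentre A'.toSubring O₀).subtype (∑ j : Fin p, c j ^ p * g₀ ^ (j : ℕ)) :=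
    looseCleanForm_of_forms hloose
  -- (4) spread from the closed centre
  obtain ⟨h₂, c', hh₂, hc', H⟩ := exists_spread_of_looseCleanForm A' O₀ hA'O₀ hA'fg h𝔭' hregR g₀ c hc hX
  -- (5) the regular locus of `A'` is open: a basic open `D(h₁) ∋ 𝔭'` inside it
  letI : Algebra k A'.toSubring := inferInstanceAs (Algebra k A')
  haveI : Algebra.FiniteType k A'.toSubring := (A'.fg_iff_finiteType.mp hA'fg : Algebra.FiniteType k A')
  have hopen : IsOpen (regularLocus A'.toSubring) := (isJ2Ring_of_field k).2 A'.toSubring inferInstance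
  have hmemReg : (⟨subringCentre A'.toSubring O₀ hA'O₀, inferInstance⟩ : PrimeSpectrum A'.toSubring) ∈
      regularLocus A'.toSubring := (isRegularLocalRing_locAtCentre_iff hA'O₀).mp hregR
  obtain ⟨_, ⟨h₁, rfl⟩, h𝔭'h₁, hsub⟩ :=
    PrimeSpectrum.isTopologicalBasis_basic_opens.exists_subset_of_mem_open hmemReg hopen
  have hh₁ : h₁ ∉ subringCentre A'.toSubring O₀ hA'O₀ := (PrimeSpectrum.mem_basicOpen _ _).mp h𝔭'h₁
  -- (6) the element to invert
  have hhh : h₁ * h₂ ∉ subringCentre A'.toSubring O₀ hA'O₀ := fun hmem =>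
    ((Ideal.IsPrime.mem_or_mem inferInstance hmem).elim hh₁ hh₂)
  have hhh0 : ((h₁ * h₂ : A'.toSubring) : K) ≠ 0 := ne_zero_of_not_mem_subringCentre A' O₀ hA'O₀ hhh
  have hvhh : O₀.valuation ((h₁ * h₂ : A'.toSubring) : K) = 1 := valuation_eq_one_of_not_mem_subringCentre hA'O₀ hhh
  have hinvO₀ : ((h₁ * h₂ : A'.toSubring) : K)⁻¹ ∈ O₀ := by
    rw [← O₀.valuation_le_one_iff, map_inv₀, hvhh, inv_one]
  -- (7) the chart `T = A'[1/(h₁h₂)]`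
  obtain ⟨s, hs⟩ := hA'fg
  let T : Subalgebra k K := Algebra.adjoin k (insert ((h₁ * h₂ : A'.toSubring) : K)⁻¹ (↑s : Set K))
  have hA'T : A' ≤ T := by
    rw [← hs]; exact Algebra.adjoin_mono (Set.subset_insert _ _)
  have hTfg : T.FG := ⟨insert ((h₁ * h₂ : A'.toSubring) : K)⁻¹ s, by rw [Finset.coe_insert]⟩
  -- `T ⊆ O₀`
  let O₀alg : Subalgebra k K :=
    { O₀.toSubring.toSubsemiring with
      algebraMap_mem' := fun r => hA'O₀ (A'.algebraMap_mem r) }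
  have hTO₀ : T.toSubring ≤ O₀.toSubring := by
    have hle : T ≤ O₀alg := by
      refine Algebra.adjoin_le (Set.insert_subset hinvO₀ fun x hx => ?_)
      exact hA'O₀ (hs ▸ Algebra.subset_adjoin hx : x ∈ A')
    exact fun x hx => hle hx
  refine ⟨T, hTfg, hAA'.trans hA'T, fun x hx => hO₀O (hTO₀ hx), fun O' hTO' => ?_⟩
  -- (8) clean-regularity at the centre of an arbitrary `O' ⊇ T`
  have hA'O' : A'.toSubring ≤ O'.toSubring := fun x hx => hTO' (hA'T hx)
  have hinvO' : ((h₁ * h₂ : A'.toSubring) : K)⁻¹ ∈ O' := hTO' (Algebra.subset_adjoin (Set.mem_insert _ _))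
  have hvhh' : O'.valuation ((h₁ * h₂ : A'.toSubring) : K) = 1 :=
    valuation_eq_one_of_inv_mem hhh0 (hA'O' (h₁ * h₂).2) hinvO'
  have hhh𝔮 : h₁ * h₂ ∉ subringCentre A'.toSubring O' hA'O' := by
    rw [mem_subringCentre_iff, hvhh']; exact lt_irrefl 1
  have hh₁𝔮 : h₁ ∉ subringCentre A'.toSubring O' hA'O' := fun hmem => hhh𝔮 (Ideal.mul_mem_right _ _ hmem)
  have hh₂𝔮 : h₂ ∉ subringCentre A'.toSubring O' hA'O' := fun hmem => hhh𝔮 (Ideal.mul_mem_left _ _ hmem)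
  -- `locAtCentre T O' = locAtCentre A' O'`
  let Lalg : Subalgebra k K :=
    { (locAtCentre A'.toSubring O').toSubsemiring with
      algebraMap_mem' := fun r => le_locAtCentre A'.toSubring O' (A'.algebraMap_mem r) }
  have hTloc : T.toSubring ≤ locAtCentre A'.toSubring O' := by
    have hle : T ≤ Lalg := by
      refine Algebra.adjoin_le (Set.insert_subset ?_ fun x hx => ?_)
      · exact inv_mem_locAtCentre (le_locAtCentre A'.toSubring O' (h₁ * h₂).2) hvhh'
      · exact le_locAtCentre A'.toSubring O' (hs ▸ Algebra.subset_adjoin hx : x ∈ A')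
    exact fun x hx => hle hx
  rw [locAtCentre_eq_of_le_of_le (fun x hx => hA'T hx) hTloc]
  -- regularity at the centre `𝔮` of `O'` on `A'`
  have hreg𝔮 : IsRegularLocalRing (Localization.AtPrime (subringCentre A'.toSubring O' hA'O')) :=
    hsub ((PrimeSpectrum.mem_basicOpen _ ⟨subringCentre A'.toSubring O' hA'O', inferInstance⟩).mpr hh₁𝔮)
  haveI hregR' : IsRegularLocalRing (locAtCentre A'.toSubring O') :=
    (isRegularLocalRing_locAtCentre_iff hA'O').mpr hreg𝔮
  by_cases h𝔮 : subringCentre A'.toSubring O' hA'O' = subringCentre A'.toSubring O₀ hA'O₀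
  · -- same centre as `O₀`: same local ring, the original representative is clean there
    rw [locAtCentre_eq_of_subringCentre_eq hA'O' hA'O₀ h𝔮]
    exact ⟨hregR, c, hc, hX⟩
  · -- another centre off `h₁ h₂`: the spread
    haveI := isLocalization_locAtCentre hA'O'
    have H' := H (subringCentre A'.toSubring O' hA'O') hh₂𝔮 h𝔮 (locAtCentre A'.toSubring O')
    exact ⟨hregR', c', hc', H'⟩

end Summit.ResolutionOfSingularities.ResolutionOfSingularities.Theorems.RadicialJung.CleanModels

end
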